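import Literature.NumberTheory.Sieve.FordMaynardLevelHalfSieve
import Literature.NumberTheory.Sieve.FordMaynardFramework
import HarnessLib

/-!
# Ford–Maynard, Theorem 2.7 (b)/(c) with the threshold as a parameter: the rung leaves of the
# `ν*(1/2, 0)` window (statements only; nothing here is asserted)

K. Ford, J. Maynard, *On the theory of prime producing sieves* (arXiv:2407.14368, 2024), Theorem 2.7:
in the family `P_ν = (γ, θ, ν) = (1/2, 0, ν)`, `0 ≤ ν < 1/3`, (b) `C⁻(1/2, 0, ν) > 0` for `ν ≥ 0.1663` and
(c) `C⁻(1/2, 0, 0.1616) = 0`; by monotonicity (Proposition 4.10) there is a threshold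
`ν*(1/2,0) ∈ (0.1616, 0.1663]` at which Type-I information of level `x^{1/2}` plus Type-II information
on `(1, x^ν]` starts to force primes. This file only NAMES the two one-sided statements with the
printed constants replaced by a parameter, over the tree's transcription
`Literature.NumberTheory.Sieve.FordMaynard.IsLowerSieveConst` (`FordMaynardLevelHalfSieve.lean`):

* `LowerSieveThresholdAt ν₁` — Theorem 2.7 (b), first clause, from `ν₁` on (the printed fact
  `FordMaynard2024_thm27b` gives it at `ν₁ = 0.1663`: `lowerSieveThresholdAt_printed`);
* `NoLowerSieveConstAt ν₀` — Theorem 2.7 (c) at `ν₀`: no `c > 0` is an admissible lower-bound sieve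
  constant at `(1/2, 0, ν₀)` (`C⁻(1/2,0,ν₀) = 0` unfolded; printed at `ν₀ = 0.1616`); it follows from
  `∀ B > 0, FordMaynard.PrimeFreeAdmissible (1/2) 0 ν₀ B` (the output shape of Theorems 6.3 (b) / 9.1) by
  `IsLowerSieveConst.nonpos_of_primeFreeAdmissible` (`FordMaynardNoLowerSieveConst.lean`);
* `TypeIStarNegWitness η γ` — the hypothesis shape of Theorem 9.1 / Theorem 6.3 (b): some
  `f ∈ 𝔉*_η(γ)` has `f(1) < −1 ≤ f` in dimensions `≥ 2` (the object an `f`-side certificate exhibits);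

together with their trivial monotonicity in the parameter. The two NAMED CLOSED INSTANCES that the
parity-ideate cell's certified-computation programme targets ("rung leaves", D-0061) —
`LowerSieveThresholdAt (1651/10000)` and `NoLowerSieveConstAt (41/250)`, NOT in print and NOT proved — are
obligations of our theories, not literature: they live under
`Summits/Parity/GeneralizedHardyLittlewood/Theorems/` as `@[conjecture]` leaves
(`LowerSieveThreshold01651`, `NoLowerSieveConst0164`) importing this file.

Provenance: statement layer written in the ideation cell `parity-ideate` (planner seat p3, 2026-08-25),
landed by the cell's literature seat; printed anchors re-read on `renders/paper-arxiv-2407.14368/p0007–p0008`.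

## References
* [FordMaynard2024PrimeSieves] K. Ford, J. Maynard, *On the theory of prime producing sieves*,
  arXiv:2407.14368v1 (2024), Theorem 2.7, Proposition 4.10, Theorem 6.3, Theorem 9.1.
-/

noncomputable section

namespace Literature.NumberTheory.Sieve.FordMaynard

/-! ### Theorem 2.7 (b) from a threshold -/

/-- **Theorem 2.7 (b), first clause, with threshold `ν₁`**: for every `ν ∈ [ν₁, 1/3)` some `c > 0` is an
admissible lower-bound sieve constant at `(γ, θ, ν) = (1/2, 0, ν)` (`C⁻(1/2, 0, ν) > 0`, Definition 4.8
unfolded as in `IsLowerSieveConst`). Printed with `ν₁ = 0.1663`.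
[cite: FordMaynard2024PrimeSieves, Theorem 2.7 (b)] -/
def LowerSieveThresholdAt (ν₁ : ℝ) : Prop :=
  ∀ ν : ℝ, ν₁ ≤ ν → ν < 1 / 3 → ∃ c : ℝ, 0 < c ∧ IsLowerSieveConst (1 / 2) 0 ν c

/-- The printed threshold: `FordMaynard2024_thm27b` is `LowerSieveThresholdAt 0.1663` plus the bounded
clause. [cite: FordMaynard2024PrimeSieves, Theorem 2.7 (b)] -/
theorem lowerSieveThresholdAt_printed (h : FordMaynard2024_thm27b) : LowerSieveThresholdAt 0.1663 := h.1

/-- A larger threshold is a weaker statement. [cite: FordMaynard2024PrimeSieves, Proposition 4.10] -/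
theorem LowerSieveThresholdAt.mono {ν₁ ν₂ : ℝ} (h12 : ν₁ ≤ ν₂) (h : LowerSieveThresholdAt ν₁) :
    LowerSieveThresholdAt ν₂ := fun ν hν hν3 => h ν (le_trans h12 hν) hν3

/-! ### Theorem 2.7 (c) at a point -/

/-- **Theorem 2.7 (c) at `ν₀`**: no positive admissible lower-bound sieve constant at `(1/2, 0, ν₀)` —
`C⁻(1/2, 0, ν₀) = 0` unfolded on `IsLowerSieveConst`. Printed at `ν₀ = 0.1616` (with the explicit `f` of
§8, `f(1) < −1`, via Theorem 6.3 (b)). [cite: FordMaynard2024PrimeSieves, Theorem 2.7 (c)] -/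
def NoLowerSieveConstAt (ν₀ : ℝ) : Prop :=
  ∀ c : ℝ, IsLowerSieveConst (1 / 2) 0 ν₀ c → c ≤ 0

/-- No constant at `ν₀` ⇒ none below `ν₀` (`IsLowerSieveConst.mono`, Proposition 4.10).
[cite: FordMaynard2024PrimeSieves, Proposition 4.10] -/
theorem NoLowerSieveConstAt.anti {ν ν₀ : ℝ} (h : ν ≤ ν₀) (H : NoLowerSieveConstAt ν₀) :
    NoLowerSieveConstAt ν := fun c hc => H c (hc.mono h)

/-- The two one-sided statements are consistent only in the order `ν₀ < ν₁`: a threshold at `ν₁` and no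
constant at `ν₀ ≥ ν₁` contradict each other (for `ν₁ < 1/3`). [cite: FordMaynard2024PrimeSieves, Proposition 4.10] -/
theorem NoLowerSieveConstAt.lt_of_threshold {ν₀ ν₁ : ℝ} (h0 : NoLowerSieveConstAt ν₀)
    (h1 : LowerSieveThresholdAt ν₁) (hν : ν₀ < 1 / 3) : ν₀ < ν₁ := by
  by_contra hle
  obtain ⟨c, hc, hcl⟩ := h1 ν₀ (not_lt.1 hle) hν
  exact absurd (h0 c hcl) (not_le.2 hc)

/-! ### The `f`-side witness shape (Theorem 9.1 / Theorem 6.3 (b)) -/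

/-- **A negative Type-I-compatible witness at `(η, γ)`**: some `f ∈ 𝔉*_η(γ)` (`MemTypeIStar`) has
`f(1) < −1` and `f(β) ≥ −1` for every `β` of dimension `≥ 2` — the hypothesis of Theorem 9.1 and, with
`η = ν`, of Theorem 6.3 (b) for `P = (γ, 0, ν)` (`C⁻(P) ≤ 1 + f(1) < 0`-direction, i.e. `C⁻(P) = 0`).
[cite: FordMaynard2024PrimeSieves, Theorem 9.1 and Theorem 6.3 (b)] -/
def TypeIStarNegWitness (η γ : ℝ) : Prop :=
  ∃ f : VecFn, MemTypeIStar η γ f ∧ f 1 (fun _ => 1) < -1 ∧ ∀ k : ℕ, 2 ≤ k → ∀ β : Fin k → ℝ, -1 ≤ f k β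

end Literature.NumberTheory.Sieve.FordMaynard
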